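import Summits.ABC.IUTFork.Cor312FrameVolumePiecesDH
import Summits.ABC.IUTFork.Cor312SettingPrVol
import Summits.ABC.IUTFork.Cor312StatementHullSetLocality
import Summits.ABC.IUTFork.Cor312Provenance
import HarnessLib

/-!
# [IUTchIII] Corollary 3.12, statement — the field-box volume pieces at the PACKET-NORMALISED real log-shells, and
# container-robustness WITH PROVENANCE at abc-iut-c312-1's print-normalised setting of record `Real.settingPrVol`

Record-only file (D-0012) of the abc-iut cell (Cor. 3.12 sub-crew, seat abc-iut-c312-6, gen 5; TEAM B real-setting lane);
TAKES NO SIDE. The third corner of this seat's frames square, and the one that matters for PROVENANCE: plan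
ADJUDICATION-SPEC §1 ties the typed conclusion to initial Θ-data `D` by abc-iut-c312-8's `Cor312Prov.IsSettingOf D P`,
whose `q`-number clause `P.negLogQ = −|log(q)|(D)` holds at the PACKET-NORMALISED container (abc-iut-c312-1 gen 5
`Real.settingPrVol`, `Cor312SettingPrVol`; abc-iut-c312-7 `negLogQ_settingPrVol_eq_neg_absLogq` /
`Cor312PilotIdelesPrProvenance`) and NOT, in general, at the constant-weighted `Real.settingDHVol` (finding
F-c312-1-g5-1). THIS file:

* §1 `Real.frameVolumePiecesPr X hlog : Cor312Vol.FrameVolumePieces (Real.logShellsDH X logv)` — the companion's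
  `frameVolumePiecesDH` (p424654: c312-3's decomposition fields, comparison onto, Haar factor volumes normalised at `𝒪`,
  real frames; EMPTY factor index at `∞`) with the WEIGHTS replaced by the packet-normalised ones, `W_{(v⃗,i)} := Pr(v⃗)/D_{v⃗}`
  (`Pr(v⃗) = Π_a n_{v_a}/[F:ℚ]^{j+1}`, abc-iut-c312-1 `weightPr` via `presAtPr`; the companion's generic
  `PadicPresentation.frameWeight` at the probability-weighted presentation);
* §2 AGREEMENT ON HULL-SETS with c312-1's packet-normalised verbatim container `Real.summandPiecesPr` at every place
  (primes: the companion's generic `sum_frameWeight_mul_mulLogvol` AT `presAtPr`; `∞`: both `0`);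
* §3 the twin `Real.situationPrFrames`/`Real.settingPrFrames` (c312-7 `Setting.ofFrames`, `hadm` DISCHARGED, binders
  EXACTLY those of `Real.settingPrVol`) and, by this seat's GENERIC hull-set locality theorem
  (`Cor312.HullSetLocality.statement_iff_of_agree`, p427194) in three lines each: same `qLocal`/`thetaLocal`/
  `negLogTheta`/`negLogQ` and **`statement_settingPrFrames_iff : (settingPrFrames …).Statement ↔ (settingPrVol …).Statement`**;
* §4 **PROVENANCE TRANSFERS**: `isSettingOf_settingPrFrames_iff` — `IsSettingOf D (settingPrFrames …) ↔
  IsSettingOf D (settingPrVol …)` (the index clauses are about the common `thetaIndex X`, the `q`-number clause transfers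
  by `negLogQ_settingPrFrames`); so every provenance-form sentence of record stated at `settingPrVol` (c312-7
  `isSettingOf_settingPrVol_qCentreDH` / `isSettingOf_settingPrVolSharp`) holds verbatim for the field-box reading of `𝕄(−)`.
[claim: Mochizuki2012, status: disputed] for the quoted setting; [cite: DupuyHilado2025, §3.6, Def. 3.6.1];
[cite: MochizukiAbsTopIII2015, Prop. 5.7 (i)(b) p. 138]. Everything proved is bookkeeping. Deliberately NOT here: Θ-boxes /
`q`-centre / ideles (binders; abc-iut-c312-3), any judgement. Typed ≠ proved; instantiated ≠ endorsed.
-/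

noncomputable section

open Set Function NumberField

namespace Summit.ABC

namespace IUTFork

namespace Thm311

namespace Real

open Cor312 Cor312Vol Cor312Prov Literature.IUT.LogThetaLattice Literature.IUT.LogVolume Literature.IUT.HodgeTheaters

variable {F : Type} [Field F] [NumberField F] (X : PilotData F) {logv : PadicLogs F} (hlog : LogvAnalytic logv)

/-! ## §1. The pieces with packet-normalised weights -/

/-- The packet-normalised frame weights: `W_{(v⃗,i)} = Pr(v⃗)/D_{v⃗}` at a prime (the companion's generic `frameWeight` at
abc-iut-c312-1's probability-weighted presentation `presAtPr`), nothing at `∞`.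
[cite: Mochizuki2012, IUTchIII Rmk. 3.1.1 (ii) p. 94] -/
def frameWeightPr : ∀ (j : (thetaIndex X).Label) (vQ : (thetaIndex X).VQ), factorIdxDH X hlog j vQ → ℝ
  | _, .inl _ => fun s => s.elim
  | j, .inr pp => by
    haveI : Fact (pp : ℕ).Prime := ⟨pp.2⟩
    exact fun s => (presAtPr X hlog pp).frameWeight j s

/-- The packet-normalised frame weights are nonnegative. [folklore] -/
theorem frameWeightPr_nonneg : ∀ (j : (thetaIndex X).Label) (vQ : (thetaIndex X).VQ)
    (s : factorIdxDH X hlog j vQ), 0 ≤ frameWeightPr X hlog j vQ s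
  | _, .inl _, s => s.elim
  | j, .inr pp, s => by
    haveI : Fact (pp : ℕ).Prime := ⟨pp.2⟩
    exact (presAtPr X hlog pp).frameWeight_nonneg j s

/-- **The field-box volume pieces of the real log-shells, PACKET-NORMALISED**: the companion's `frameVolumePiecesDH`
(same field factors, comparison, Haar factor volumes, frames) with the weights `Pr(v⃗)/D_{v⃗}`.
[claim: Mochizuki2012, status: disputed] -/
def frameVolumePiecesPr : FrameVolumePieces (logShellsDH X logv) :=
  { frameVolumePiecesDH X hlog with
    w := frameWeightPr X hlog
    w_nonneg := frameWeightPr_nonneg X hlog }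

/-- Its comparison is c312-5's `factorMapDH`. [folklore] -/
theorem frameVolumePiecesPr_e : (frameVolumePiecesPr X hlog).e = factorMapDH X hlog := rfl

/-- The packet-normalised pieces for the ANALYTIC logarithm family — no hypothesis beyond `X`.
[claim: Mochizuki2012, status: disputed] -/
def frameVolumePiecesPrAnalytic : FrameVolumePieces (logShellsDH X (analyticLogv F)) :=
  frameVolumePiecesPr X (logvAnalytic_analyticLogv (F := F))

/-! ## §2. Agreement with the packet-normalised verbatim container on hull-sets -/

section Agreement

variable (M : Type) [Field M] [NumberField M]
  (archPk : ∀ (j : (thetaIndex X).Label) (vQ : (thetaIndex X).VQ), Set ((logShellsDH X logv).Packet j vQ))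
  (archSub : ∀ (j : (thetaIndex X).Label) (v : (thetaIndex X).V),
    Set ((logShellsDH X logv).Packet j ((thetaIndex X).over v)))
  (Ψ : ℤ → ∀ v : (thetaIndex X).V, v ∈ (thetaIndex X).Vbad → Set ((logShellsDH X logv).StarPacket v))
  (act : ℤ → ∀ v : (thetaIndex X).V, v ∈ (thetaIndex X).Vbad →
    (logShellsDH X logv).StarPacket v → Module.End ℚ ((logShellsDH X logv).StarPacket v))
  (Mmod : ℤ → ∀ j : (thetaIndex X).LabelStar, Set ((logShellsDH X logv).GlobalPacket j.1))
  (region : ℤ → ∀ j : (thetaIndex X).LabelStar, FinDivisor M → ∀ vQ : (thetaIndex X).VQ,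
    Set ((logShellsDH X logv).Packet j.1 vQ))
  (n : ℤ)

/-- **Field-box log-volume (packet-normalised weights) = abc-iut-c312-1's packet-normalised verbatim container on
hull-set preimages, at EVERY place** (for `λ_s ≠ 0`): at a prime the companion's `sum_frameWeight_mul_mulLogvol` at
`presAtPr`; at `∞` both sides `0`. [claim: Mochizuki2012, status: disputed] [cite: MochizukiAbsTopIII2015, Prop. 5.7 (i)(b) p. 138] -/
theorem logvol_frameVolumePiecesPr_preimage_hullSet : ∀ (j : (thetaIndex X).Label) (vQ : (thetaIndex X).VQ)
    (c : ∀ s : factorIdxDH X hlog j vQ, factorFieldDH X hlog j vQ s), (∀ s, c s ≠ 0) →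
    (frameVolumePiecesPr X hlog).logvol j vQ (factorMapDH X hlog j vQ ⁻¹' hullSet (factorFieldDH X hlog j vQ) c) =
      ((situationPrVol X hlog M archPk archSub Ψ act Mmod region).D n).logvol j vQ
        (factorMapDH X hlog j vQ ⁻¹' hullSet (factorFieldDH X hlog j vQ) c)
  | j, .inl u, c, _ => by
    have h1 : (frameVolumePiecesPr X hlog).logvol j (.inl u)
        (factorMapDH X hlog j (.inl u) ⁻¹' hullSet (factorFieldDH X hlog j (.inl u)) c) = 0 := by
      unfold FrameVolumePieces.logvol
      exact Finset.sum_eq_zero fun s _ => s.elim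
    have h2 : ((situationPrVol X hlog M archPk archSub Ψ act Mmod region).D n).logvol j (.inl u)
        (factorMapDH X hlog j (.inl u) ⁻¹' hullSet (factorFieldDH X hlog j (.inl u)) c) = 0 := by
      show (summandPiecesPr X hlog).logvol j (.inl u) _ = 0
      unfold SummandPieces.logvol
      exact Finset.sum_eq_zero fun e _ => by
        show (0 : ℝ) * _ = 0
        exact zero_mul _
    rw [h1, h2]
  | j, .inr pp, c, hc => by
    haveI : Fact (pp : ℕ).Prime := ⟨pp.2⟩
    letI hCF : Fintype ((thetaIndex X).Caps j → (thetaIndex X).Fibre (.inr pp)) := Fintype.ofFinite _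
    rw [show factorMapDH X hlog j (.inr pp) ⁻¹' hullSet (factorFieldDH X hlog j (.inr pp)) c =
        (frameVolumePiecesPr X hlog).e j (.inr pp) ⁻¹' hullSet ((frameVolumePiecesPr X hlog).K j (.inr pp)) c
        from rfl, (frameVolumePiecesPr X hlog).logvol_preimage_hullSet j (.inr pp) c]
    show (∑ s : (presAtPr X hlog pp).factorIdx j, (presAtPr X hlog pp).frameWeight j s *
        ((presAtPr X hlog pp).factorVolume j s).mulLogvol (c s)) =
      ((situationPrVol X hlog M archPk archSub Ψ act Mmod region).D n).logvol j (.inr pp)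
        (factorMapDH X hlog j (.inr pp) ⁻¹' hullSet (factorFieldDH X hlog j (.inr pp)) c)
    exact (presAtPr X hlog pp).sum_frameWeight_mul_mulLogvol j c hc

/-- The same for an arbitrary hull-set `H = λ·𝒪_L`. [claim: Mochizuki2012, status: disputed] -/
theorem logvol_frameVolumePiecesPr_preimage_of_isHullSet (j : (thetaIndex X).Label) (vQ : (thetaIndex X).VQ)
    {H : Set (∀ s : factorIdxDH X hlog j vQ, factorFieldDH X hlog j vQ s)} (hH : IsHullSet (factorFieldDH X hlog j vQ) H) :
    (frameVolumePiecesPr X hlog).logvol j vQ (factorMapDH X hlog j vQ ⁻¹' H) =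
      ((situationPrVol X hlog M archPk archSub Ψ act Mmod region).D n).logvol j vQ (factorMapDH X hlog j vQ ⁻¹' H) := by
  obtain ⟨c, hc, rfl⟩ := hH
  exact logvol_frameVolumePiecesPr_preimage_hullSet X hlog M archPk archSub Ψ act Mmod region n j vQ c hc

/-! ## §3. The packet-normalised field-box twin and container-robustness (via hull-set locality) -/

/-- The situation of Thm. 3.11 over the real log-shells with the PACKET-NORMALISED FIELD-BOX volumes.
[claim: Mochizuki2012, status: disputed] -/
abbrev situationPrFrames : Situation (thetaIndex X) :=
  Situation.ofShells (logShellsDH X logv) M archPk archSub (frameVolumePiecesPr X hlog).Adm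
    (frameVolumePiecesPr X hlog).logvol Ψ act Mmod region

/-- Every line of `situationPrFrames` carries the pieces' volumes (by `rfl`). [folklore] -/
theorem realizes_situationPrFrames :
    (frameVolumePiecesPr X hlog).Realizes ((situationPrFrames X hlog M archPk archSub Ψ act Mmod region).D n) :=
  ⟨fun _ _ _ => Iff.rfl, fun _ _ _ => rfl⟩

variable {HT : Type} {LogLink : HT → HT → Type} {IsFull : ∀ {s t : HT}, LogLink s t → Prop}
  (lat : LGPGaussianLogThetaLattice LogLink IsFull)
  {Frd : Type} {IsoF : Frd → Frd → Type} {Ob : Frd → Type} {realify : Frd → Frd} {Strip : Type}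
  {IsoS : Strip → Strip → Type} {Mv : ∀ v : (thetaIndex X).V, v ∈ (thetaIndex X).Vbad → Type}
  [∀ v h, Monoid (Mv v h)]
  (sig : GlobalLGPFrobenioidSignature (thetaIndex X).lstar (thetaIndex X).V (· ∈ (thetaIndex X).Vbad)
    Frd IsoF Ob realify Strip IsoS Mv)
  (split : SplittingMonoids Mv) {ObΔ : Type} {N : ∀ v : (thetaIndex X).V, v ∈ (thetaIndex X).Vbad → Type}
  [∀ v h, Monoid (N v h)] (qData : QPilotData ObΔ N)
  (thetaBox : ℤ → Ob sig.Clgp → ∀ (j : (thetaIndex X).Label) (vQ : (thetaIndex X).VQ),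
    Set (∀ s : factorIdxDH X hlog j vQ, factorFieldDH X hlog j vQ s))
  (qCentre : ObΔ → ∀ (j : (thetaIndex X).Label) (vQ : (thetaIndex X).VQ),
    ∀ s : factorIdxDH X hlog j vQ, factorFieldDH X hlog j vQ s)
  (hq : ∀ j vQ s, qCentre (qPilotObject qData) j vQ s ≠ 0)
  (hfin : ∀ j : (thetaIndex X).Label, (Function.support fun vQ =>
    ((situationPrVol X hlog M archPk archSub Ψ act Mmod region).D n).logvol j vQ
      (factorMapDH X hlog j vQ ⁻¹' hullSet (factorFieldDH X hlog j vQ) (qCentre (qPilotObject qData) j vQ))).Finite)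

include hq in
/-- The `q`-supports agree, so `Real.settingPrVol`'s binder `hfin` serves both containers. [folklore] -/
theorem qSupport_framesPr_eq (j : (thetaIndex X).Label) :
    (Function.support fun vQ => ((situationPrFrames X hlog M archPk archSub Ψ act Mmod region).D n).logvol j vQ
      (factorMapDH X hlog j vQ ⁻¹' hullSet (factorFieldDH X hlog j vQ) (qCentre (qPilotObject qData) j vQ))) =
    (Function.support fun vQ => ((situationPrVol X hlog M archPk archSub Ψ act Mmod region).D n).logvol j vQ
      (factorMapDH X hlog j vQ ⁻¹' hullSet (factorFieldDH X hlog j vQ) (qCentre (qPilotObject qData) j vQ))) := by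
  ext vQ
  simp only [Function.mem_support, ne_eq]
  rw [show ((situationPrFrames X hlog M archPk archSub Ψ act Mmod region).D n).logvol j vQ
      (factorMapDH X hlog j vQ ⁻¹' hullSet (factorFieldDH X hlog j vQ) (qCentre (qPilotObject qData) j vQ)) =
      (frameVolumePiecesPr X hlog).logvol j vQ
        (factorMapDH X hlog j vQ ⁻¹' hullSet (factorFieldDH X hlog j vQ) (qCentre (qPilotObject qData) j vQ)) from rfl,
    logvol_frameVolumePiecesPr_preimage_hullSet X hlog M archPk archSub Ψ act Mmod region n j vQ _ (hq j vQ)]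

/-- **The setting of [IUTchIII] Cor. 3.12 over the real log-shells with the PACKET-NORMALISED field-box volumes** —
c312-7's `Setting.ofFrames` over the pieces' `toRealFrames thetaBox qCentre` (`hadm` DISCHARGED by `hadm_of_realizes`),
binders EXACTLY those of abc-iut-c312-1's `Real.settingPrVol` (`hfin` transported). [claim: Mochizuki2012, status: disputed] -/
def settingPrFrames : Cor312.Setting (situationPrFrames X hlog M archPk archSub Ψ act Mmod region) :=
  Setting.ofFrames n lat sig split qData
    (FrameVolumePieces.toRealFrames (S := situationPrFrames X hlog M archPk archSub Ψ act Mmod region)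
      (frameVolumePiecesPr X hlog) thetaBox qCentre) hq
    (FrameVolumePieces.hadm_of_realizes (S := situationPrFrames X hlog M archPk archSub Ψ act Mmod region)
      (V := frameVolumePiecesPr X hlog)
      (realizes_situationPrFrames X hlog M archPk archSub Ψ act Mmod region n))
    (fun j => (qSupport_framesPr_eq X hlog M archPk archSub Ψ act Mmod region n qData qCentre hq j).symm ▸ hfin j)

/-- The two log-volumes agree on every hull-set of every frame of `settingPrFrames` (the frames are c312-7's real
frames pulled back along `factorMapDH`; §2). [folklore] -/
theorem logvol_agree_on_hul_settingPrFrames (j : (thetaIndex X).Label) (vQ : (thetaIndex X).VQ) :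
    ∀ H ∈ ((settingPrFrames X hlog M archPk archSub Ψ act Mmod region n lat sig split qData thetaBox qCentre hq
      hfin).frame j vQ).Hul,
      (frameVolumePiecesPr X hlog).logvol j vQ H = (summandPiecesPr X hlog).logvol j vQ H := by
  rintro _ ⟨H', hH', rfl⟩
  exact logvol_frameVolumePiecesPr_preimage_of_isHullSet X hlog M archPk archSub Ψ act Mmod region n j vQ hH'

/-- Same hull frames as `Real.settingPrVol` (c312-7 `HullFrame.ofComparison = (ofLocalFields _).comap _`). [folklore] -/
theorem frame_settingPrFrames : ∀ (j : (thetaIndex X).Label) (vQ : (thetaIndex X).VQ),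
    (settingPrFrames X hlog M archPk archSub Ψ act Mmod region n lat sig split qData thetaBox qCentre hq hfin).frame j vQ =
      (settingPrVol X hlog M archPk archSub Ψ act Mmod region n lat sig split qData thetaBox qCentre hq hfin).frame j vQ :=
  fun _ _ => rfl

/-- Same (Ind3)-enlarged Θ-regions as `Real.settingPrVol` (same Θ-boxes, same comparison). [folklore] -/
theorem thetaRegion3_settingPrFrames : ∀ (j : (thetaIndex X).Label) (vQ : (thetaIndex X).VQ),
    (settingPrFrames X hlog M archPk archSub Ψ act Mmod region n lat sig split qData thetaBox qCentre hq hfin).thetaRegion3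
        j vQ =
      (settingPrVol X hlog M archPk archSub Ψ act Mmod region n lat sig split qData thetaBox qCentre hq hfin).thetaRegion3
        j vQ :=
  fun _ _ => rfl

/-- Same `q`-pilot regions as `Real.settingPrVol`. [folklore] -/
theorem qRegion_settingPrFrames : ∀ (j : (thetaIndex X).Label) (vQ : (thetaIndex X).VQ),
    (settingPrFrames X hlog M archPk archSub Ψ act Mmod region n lat sig split qData thetaBox qCentre hq hfin).qRegion j vQ =
      (settingPrVol X hlog M archPk archSub Ψ act Mmod region n lat sig split qData thetaBox qCentre hq hfin).qRegion j vQ :=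
  fun _ _ => rfl

/-- **Same local `q`-volume** as `Real.settingPrVol` (hull-set locality, p427194). [claim: Mochizuki2012, status: disputed] -/
theorem qLocal_settingPrFrames (j : (thetaIndex X).Label) (vQ : (thetaIndex X).VQ) :
    (settingPrFrames X hlog M archPk archSub Ψ act Mmod region n lat sig split qData thetaBox qCentre hq hfin).qLocal j vQ =
      (settingPrVol X hlog M archPk archSub Ψ act Mmod region n lat sig split qData thetaBox qCentre hq hfin).qLocal j vQ :=
  HullSetLocality.qLocal_eq (qRegion_settingPrFrames X hlog M archPk archSub Ψ act Mmod region n lat sig split qData thetaBox qCentre hq hfin)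
    (logvol_agree_on_hul_settingPrFrames X hlog M archPk archSub Ψ act Mmod region n lat sig split qData thetaBox qCentre
      hq hfin) j vQ

/-- **Same local `−|log(Θ)|`** as `Real.settingPrVol`. [claim: Mochizuki2012, status: disputed] -/
theorem thetaLocal_settingPrFrames (j : (thetaIndex X).Label) (vQ : (thetaIndex X).VQ) :
    (settingPrFrames X hlog M archPk archSub Ψ act Mmod region n lat sig split qData thetaBox qCentre hq hfin).thetaLocal
        j vQ =
      (settingPrVol X hlog M archPk archSub Ψ act Mmod region n lat sig split qData thetaBox qCentre hq hfin).thetaLocal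
        j vQ :=
  HullSetLocality.thetaLocal_eq (frame_settingPrFrames X hlog M archPk archSub Ψ act Mmod region n lat sig split qData thetaBox qCentre hq hfin)
    (thetaRegion3_settingPrFrames X hlog M archPk archSub Ψ act Mmod region n lat sig split qData thetaBox qCentre hq hfin)
    (logvol_agree_on_hul_settingPrFrames X hlog M archPk archSub Ψ act Mmod region n lat sig split qData thetaBox qCentre
      hq hfin) j vQ

/-- **Same `−|log(Θ)|`** as `Real.settingPrVol`. [claim: Mochizuki2012, status: disputed] -/
theorem negLogTheta_settingPrFrames :
    (settingPrFrames X hlog M archPk archSub Ψ act Mmod region n lat sig split qData thetaBox qCentre hq hfin).negLogTheta =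
      (settingPrVol X hlog M archPk archSub Ψ act Mmod region n lat sig split qData thetaBox qCentre hq hfin).negLogTheta :=
  HullSetLocality.negLogTheta_eq (frame_settingPrFrames X hlog M archPk archSub Ψ act Mmod region n lat sig split qData thetaBox qCentre hq hfin)
    (thetaRegion3_settingPrFrames X hlog M archPk archSub Ψ act Mmod region n lat sig split qData thetaBox qCentre hq hfin)
    (logvol_agree_on_hul_settingPrFrames X hlog M archPk archSub Ψ act Mmod region n lat sig split qData thetaBox qCentre
      hq hfin)

/-- **Same `−|log(q)|`** as `Real.settingPrVol`. [claim: Mochizuki2012, status: disputed] -/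
theorem negLogQ_settingPrFrames :
    (settingPrFrames X hlog M archPk archSub Ψ act Mmod region n lat sig split qData thetaBox qCentre hq hfin).negLogQ =
      (settingPrVol X hlog M archPk archSub Ψ act Mmod region n lat sig split qData thetaBox qCentre hq hfin).negLogQ :=
  HullSetLocality.negLogQ_eq (qRegion_settingPrFrames X hlog M archPk archSub Ψ act Mmod region n lat sig split qData thetaBox qCentre hq hfin)
    (logvol_agree_on_hul_settingPrFrames X hlog M archPk archSub Ψ act Mmod region n lat sig split qData thetaBox qCentre
      hq hfin)

/-- **CONTAINER-ROBUSTNESS AT THE PRINT-NORMALISED SETTING OF RECORD.** The typed [IUTchIII] Cor. 3.12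
(`Cor312.Setting.Statement`, p. 174 l. 16–18) holds for the real log-shells of `F` with packet-normalised FIELD-BOX volumes
iff it holds for abc-iut-c312-1's packet-normalised VERBATIM summandwise container `Real.settingPrVol` — same binders; an
instance of this seat's hull-set locality theorem (p427194). Neither side asserted. [claim: Mochizuki2012, status: disputed] -/
theorem statement_settingPrFrames_iff :
    (settingPrFrames X hlog M archPk archSub Ψ act Mmod region n lat sig split qData thetaBox qCentre hq hfin).Statement ↔
      (settingPrVol X hlog M archPk archSub Ψ act Mmod region n lat sig split qData thetaBox qCentre hq hfin).Statement :=
  HullSetLocality.statement_iff_of_agree (frame_settingPrFrames X hlog M archPk archSub Ψ act Mmod region n lat sig split qData thetaBox qCentre hq hfin)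
    (thetaRegion3_settingPrFrames X hlog M archPk archSub Ψ act Mmod region n lat sig split qData thetaBox qCentre hq hfin) (qRegion_settingPrFrames X hlog M archPk archSub Ψ act Mmod region n lat sig split qData thetaBox qCentre hq hfin)
    (logvol_agree_on_hul_settingPrFrames X hlog M archPk archSub Ψ act Mmod region n lat sig split qData thetaBox qCentre
      hq hfin)

/-! ## §4. Provenance transfers -/

variable {K Fbar : Type} [Field K] [NumberField K] [Algebra F K] [Field Fbar] [Algebra F Fbar] [Algebra K Fbar]
  {E : WeierstrassCurve F} [E.IsElliptic] {l : ℕ} {Pb : BadPlacePredicates K} {D : InitialThetaData F K Fbar E l Pb}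

/-- **`IsSettingOf D` TRANSFERS between the two readings of `𝕄(−)`**: abc-iut-c312-8's provenance link (index skeleton
`(l−1)/2`, places, finiteness of `𝕍(F)^bad`, and the `q`-number clause `P.negLogQ = −|log(q)|(D)`) holds for the
packet-normalised field-box setting iff it holds for abc-iut-c312-1's `Real.settingPrVol` — the index clauses concern the
common `thetaIndex X`, the number clause transfers by `negLogQ_settingPrFrames`. [claim: Mochizuki2012, status: disputed] -/
theorem isSettingOf_settingPrFrames_iff :
    IsSettingOf D (settingPrFrames X hlog M archPk archSub Ψ act Mmod region n lat sig split qData thetaBox qCentre hq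
      hfin) ↔
    IsSettingOf D (settingPrVol X hlog M archPk archSub Ψ act Mmod region n lat sig split qData thetaBox qCentre hq hfin) := by
  constructor
  · intro h
    exact ⟨h.lstar_eq, h.places, h.VFbad_finite, by
      rw [← negLogQ_settingPrFrames X hlog M archPk archSub Ψ act Mmod region n lat sig split qData thetaBox qCentre hq hfin]
      exact h.negLogQ_eq⟩
  · intro h
    exact ⟨h.lstar_eq, h.places, h.VFbad_finite, by
      rw [negLogQ_settingPrFrames X hlog M archPk archSub Ψ act Mmod region n lat sig split qData thetaBox qCentre hq hfin]
      exact h.negLogQ_eq⟩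

/-- Hence, under provenance at either reading, the typed Cor. 3.12 at the field-box setting is the curve's inequality of
record `−|log(q)|(D) ≤ −|log(Θ)|` exactly as at `Real.settingPrVol` (c312-8's `numbersOf_cor312_iff` composes with
`statement_settingPrFrames_iff`). Stated as the conjunction transfer. [claim: Mochizuki2012, status: disputed] -/
theorem isSettingOf_and_statement_settingPrFrames_iff :
    (IsSettingOf D (settingPrFrames X hlog M archPk archSub Ψ act Mmod region n lat sig split qData thetaBox qCentre hq
        hfin) ∧
      (settingPrFrames X hlog M archPk archSub Ψ act Mmod region n lat sig split qData thetaBox qCentre hq hfin).Statement) ↔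
    (IsSettingOf D (settingPrVol X hlog M archPk archSub Ψ act Mmod region n lat sig split qData thetaBox qCentre hq hfin) ∧
      (settingPrVol X hlog M archPk archSub Ψ act Mmod region n lat sig split qData thetaBox qCentre hq hfin).Statement) :=
  and_congr (isSettingOf_settingPrFrames_iff X hlog M archPk archSub Ψ act Mmod region n lat sig split qData thetaBox qCentre
    hq hfin) (statement_settingPrFrames_iff X hlog M archPk archSub Ψ act Mmod region n lat sig split qData thetaBox qCentre
    hq hfin)

end Agreement

end Real

end Thm311

end IUTFork

end Summit.ABC

end
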